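import Mathlib.RingTheory.Polynomial.ScaleRoots
import Mathlib.RingTheory.Polynomial.UniqueFactorization
import Mathlib.RingTheory.Localization.FractionRing
import Mathlib.Algebra.MvPolynomial.Funext
import Mathlib.Algebra.Polynomial.Div
import Mathlib.Algebra.Polynomial.Degree.SmallDegree
import Mathlib.Algebra.Field.ZMod
import Literature.Barriers.ValiantsHypothesis.BIJL18PermanentZeroZMatrixProofs
import Literature.Computability.AlgebraicComplexity.PermanentIrreducible
import Literature.Computability.AlgebraicComplexity.StandardFamiliesProofs
import HarnessLib

/-!
# Bläser–Ikenmeyer–Jindal–Lysikov 2018, §6 — the algebraic core of the proofs of Thms. 5 and 6: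
# the self-reduction substitution `C ↦ C(Z(X))` has kernel `(Per)`

Sibling proof file of `BIJL18PermanentZero.lean` (val-lit cell, seat t23). Source: M. Bläser,
C. Ikenmeyer, G. Jindal, V. Lysikov, *Generalized matrix completion and algebraic natural proofs*,
STOC 2018 = ECCC TR18-064 [BlaserIkenmeyerJindalLysikov2018], §6 (ECCC p.18). HONEST FRAMING:
typed literature infrastructure; `VP ≠ VNP` is NOT proved and nothing here is progress on it; the
named facts `BIJL2018_thm5` / `BIJL2018_thm6` (`P^{#P} ⊆ ∃BPP` conclusions) are NOT discharged here —
their randomised machine content (PIT, Kaltofen over `𝔽_p`, steps 3, 6, 7 of the printed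
algorithm) is untouched.

**What is printed (ECCC p.18, proof of Thm. 5).** With `Z = Z_k(X)` the matrix of §6
(`zMatrix`: `z_{ij} = x_{ij}` for `i < k`, `z_{kj} = x_{kj}·Per(X_{kk})`, `z_{kk} = −Σ_{j<k} x_{kj}·Per(X_{kj})`,
so that `Per Z = 0`), step 3 checks "`C_k(Z_k(X)) = 0`" and step 4 concludes: "By Hilbert's
Nullstellensatz, the polynomial computed by `C_k` has the form `(Per_k)^e h` with `e ≤ d(k)/k` and
`gcd((Per_k)^e, h) = 1`. Note that `Per_k` is irreducible." The proof of Thm. 6 (ECCC p.19) runs the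
same steps on a `VP⁰`-natural proof `D_k` ("a polynomial that vanishes on all `k×k`-matrices" of
permanent zero).

**What this file proves (all fields `K`; `k = n + 1`).**
* `PerZeroDivisibility.zSubst K n` — the `K`-algebra endomorphism `C ↦ C(Z(X))` of
  `K[x_{ij} : i, j ≤ n]`, and `zSubst_perPoly : zSubst (Per) = 0` (`Per Z(X) = 0` over any
  commutative ring, `permanent_zMatrix_eq_zero`).
* `perPoly_dvd_iff_zSubst_eq_zero : Per ∣ C ↔ C(Z(X)) = 0` — the kernel of the self-reduction
  substitution is exactly the (prime) principal ideal `(Per)`. This is the algebraic content of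
  step 4 given step 3; the printed "Hilbert's Nullstellensatz" is replaced by an elementary division
  argument in the variable `x_{kk}` (`Per = x_{kk}·a + b` with `a = Per(X_{kk}) ≠ 0`, scale-roots in
  the fraction field) plus primality of `Per` (`perPoly_irreducible`, von zur Gathen), so it holds
  over EVERY field, not only algebraically closed ones.
* `exists_eq_perPoly_pow_mul` — the multiplicity form "`C = Per^e · h`, `e ≥ 1`, `Per ∤ h`,
  `e·k ≤ deg C`" for `C ≠ 0` with `C(Z(X)) = 0`.
* `perPoly_dvd_of_forall_permanent_eq_zero` — over an infinite field, a polynomial vanishing at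
  every matrix of permanent zero is a multiple of `Per` (the set-theoretic reading used for Thm. 6),
  and `hasVP0NaturalProofsAgainstPerZero_iff_perPoly_dvd` — the typed hypothesis of the
  LOAD-BEARING fact `BIJL2018_thm6` is EQUIVALENT to "`VP⁰` contains a family of nonzero multiples
  of `Per_n` (over `ℚ`)".

Rendering notes. `Per(X_{kk})` and `Per(X_{kj})` are the permanents of the submatrices of the
generic matrix `Matrix.mvPolynomialX` (`lastMinor`, `colMinor`); `b = Σ_{j<k} x_{kj}·Per(X_{kj})`
is `lastRowSum`, so that the Laplace expansion along the last row reads `Per = x_{kk}·a + b`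
(`perPoly_eq_X_mul_lastMinor_add`) and `z_{kk} = −b`. Theorem-and-definition file; no named facts.
-/

noncomputable section

namespace Literature.Barriers.ValiantsHypothesis

open MvPolynomial Literature.Computability.AlgebraicComplexity

universe u

namespace PerZeroDivisibility

/-! ### `Z(X)` over a commutative ring: base change and `Per Z(X) = 0` -/

section CommRing

variable {R : Type u} [CommRing R] {S : Type*} [CommRing S] {n : ℕ}

/-- Ring homomorphisms commute with permanents (plumbing). [folklore] -/
private theorem map_permanent_eq {m : Type*} [Fintype m] [DecidableEq m] (f : R →+* S)
    (A : Matrix m m R) : f A.permanent = (A.map f).permanent := by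
  simp [Matrix.permanent, map_sum, map_prod]

/-- The construction `X ↦ Z(X)` of §6 commutes with ring homomorphisms applied entrywise (its
entries are integer polynomial expressions in the entries of `X`).
[cite: BlaserIkenmeyerJindalLysikov2018, §6 (construction of `Z`)] locator: ECCC p.18 -/
theorem zMatrix_map (f : R →+* S) (X : Matrix (Fin (n + 1)) (Fin (n + 1)) R) :
    (zMatrix X).map f = zMatrix (X.map f) := by
  ext i j
  by_cases hi : i = Fin.last n
  · subst hi
    by_cases hj : j = Fin.last n
    · subst hj
      simp only [Matrix.map_apply, zMatrix, ne_eq, not_true_eq_false, if_false, map_neg, map_sum,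
        map_mul, map_permanent_eq]
      rfl
    · simp only [Matrix.map_apply, zMatrix, ne_eq, not_true_eq_false, if_false, hj,
        not_false_eq_true, if_true, map_mul, map_permanent_eq]
      rfl
  · simp [zMatrix, hi]

/-- **§6: `Per Z(X) = 0`**, over any commutative ring (Laplace expansion along the last row; the
field case is `permanent_zMatrix`). [cite: BlaserIkenmeyerJindalLysikov2018, §6 (construction of `Z`)]
locator: ECCC p.18 -/
theorem permanent_zMatrix_eq_zero (X : Matrix (Fin (n + 1)) (Fin (n + 1)) R) :
    (zMatrix X).permanent = 0 := by
  rw [Matrix.permanent_eq_sum_row _ (Fin.last n), Fin.sum_univ_castSucc]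
  have hsub : ∀ c : Fin n → Fin (n + 1),
      (zMatrix X).submatrix (Fin.last n).succAbove c = X.submatrix (Fin.last n).succAbove c := by
    intro c
    ext i j
    simp [zMatrix]
  have hlast : zMatrix X (Fin.last n) (Fin.last n) = -∑ j' : Fin n, X (Fin.last n) (Fin.castSucc j') *
      (X.submatrix (Fin.last n).succAbove (Fin.castSucc j').succAbove).permanent := by
    simp [zMatrix]
  have hoff : ∀ j' : Fin n, zMatrix X (Fin.last n) (Fin.castSucc j') =
      X (Fin.last n) (Fin.castSucc j') *
        (X.submatrix (Fin.last n).succAbove (Fin.last n).succAbove).permanent := by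
    intro j'
    simp [zMatrix, (Fin.castSucc_lt_last j').ne]
  simp only [hsub, hlast, hoff]
  have h : ∀ j' : Fin n, X (Fin.last n) (Fin.castSucc j') *
      (X.submatrix (Fin.last n).succAbove (Fin.last n).succAbove).permanent *
      (X.submatrix (Fin.last n).succAbove (Fin.castSucc j').succAbove).permanent =
      X (Fin.last n) (Fin.castSucc j') *
        (X.submatrix (Fin.last n).succAbove (Fin.castSucc j').succAbove).permanent *
        (X.submatrix (Fin.last n).succAbove (Fin.last n).succAbove).permanent := fun j' => by ring
  simp only [h, ← Finset.sum_mul]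
  ring

end CommRing

/-! ### The self-reduction substitution `C ↦ C(Z(X))` on `K[x_{ij}]` -/

section Field

variable (K : Type u) [Field K] (n : ℕ)

/-- The point `Z(X) ∈ K[x]^{k×k}` (`k = n+1`): coordinates of the matrix `Z(X)` of §6 built from the
GENERIC matrix `X = (x_{ij})` (`Matrix.mvPolynomialX`), indexed by `(i, j)`.
[cite: BlaserIkenmeyerJindalLysikov2018, §6 (proof of Thm. 5, step 3)] locator: ECCC p.18 -/
def zPoint (v : Fin (n + 1) × Fin (n + 1)) : MvPolynomial (Fin (n + 1) × Fin (n + 1)) K :=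
  zMatrix (Matrix.mvPolynomialX (Fin (n + 1)) (Fin (n + 1)) K) v.1 v.2

/-- **The self-reduction substitution `C ↦ C(Z_k(X))`** (ECCC p.18, step 3: "check that
`C_k(Z_k(X)) = 0`"), as a `K`-algebra endomorphism of `K[x_{ij} : i, j < k]`, `k = n + 1`.
[cite: BlaserIkenmeyerJindalLysikov2018, §6 (proof of Thm. 5, step 3)] locator: ECCC p.18 -/
def zSubst : MvPolynomial (Fin (n + 1) × Fin (n + 1)) K →ₐ[K] MvPolynomial (Fin (n + 1) × Fin (n + 1)) K :=
  aeval (zPoint K n)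

/-- `a := Per(X_{kk})`, the permanent of the generic matrix with the last row and column removed.
[cite: BlaserIkenmeyerJindalLysikov2018, §6 (construction of `Z`)] locator: ECCC p.18 -/
def lastMinor : MvPolynomial (Fin (n + 1) × Fin (n + 1)) K :=
  ((Matrix.mvPolynomialX (Fin (n + 1)) (Fin (n + 1)) K).submatrix
    (Fin.last n).succAbove (Fin.last n).succAbove).permanent

/-- `Per(X_{kj})` for `j < k`: the permanent of the generic matrix with the last row and column `j`
removed. [cite: BlaserIkenmeyerJindalLysikov2018, §6 (construction of `Z`)] locator: ECCC p.18 -/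
def colMinor (j' : Fin n) : MvPolynomial (Fin (n + 1) × Fin (n + 1)) K :=
  ((Matrix.mvPolynomialX (Fin (n + 1)) (Fin (n + 1)) K).submatrix
    (Fin.last n).succAbove (Fin.castSucc j').succAbove).permanent

/-- `b := Σ_{j<k} x_{kj}·Per(X_{kj})`, so that `z_{kk} = −b` and `Per X = x_{kk}·a + b`.
[cite: BlaserIkenmeyerJindalLysikov2018, §6 (construction of `Z`)] locator: ECCC p.18 -/
def lastRowSum : MvPolynomial (Fin (n + 1) × Fin (n + 1)) K :=
  ∑ j' : Fin n, X (Fin.last n, Fin.castSucc j') * colMinor K n j'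

variable {K n}

/-- `z_{ij} = x_{ij}` off the last row. [cite: BlaserIkenmeyerJindalLysikov2018, §6 (construction of `Z`)]
locator: ECCC p.18 -/
theorem zPoint_of_ne {v : Fin (n + 1) × Fin (n + 1)} (hv : v.1 ≠ Fin.last n) :
    zPoint K n v = X v := by
  rcases v with ⟨i, j⟩
  simp only [zPoint, zMatrix, ne_eq] at hv ⊢
  simp [hv, Matrix.mvPolynomialX]

/-- `z_{kj} = x_{kj}·a` for `j < k`. [cite: BlaserIkenmeyerJindalLysikov2018, §6 (construction of `Z`)]
locator: ECCC p.18 -/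
theorem zPoint_last_of_ne {j : Fin (n + 1)} (hj : j ≠ Fin.last n) :
    zPoint K n (Fin.last n, j) = X (Fin.last n, j) * lastMinor K n := by
  simp [zPoint, zMatrix, lastMinor, hj, Matrix.mvPolynomialX]

/-- `z_{kk} = −b`. [cite: BlaserIkenmeyerJindalLysikov2018, §6 (construction of `Z`)] locator: ECCC p.18 -/
theorem zPoint_last_last : zPoint K n (Fin.last n, Fin.last n) = -lastRowSum K n := by
  simp [zPoint, zMatrix, lastRowSum, colMinor, Matrix.mvPolynomialX]

/-- `zSubst` on a variable. [cite: BlaserIkenmeyerJindalLysikov2018, §6 (proof of Thm. 5, step 3)]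
locator: ECCC p.18 -/
theorem zSubst_X (v : Fin (n + 1) × Fin (n + 1)) : zSubst K n (X v) = zPoint K n v := by
  simp [zSubst]

/-- The minors of the generic matrix are renamings of the generic `n × n` permanent (plumbing).
[folklore] -/
private theorem permanent_submatrix_mvPolynomialX (r c : Fin n → Fin (n + 1)) :
    ((Matrix.mvPolynomialX (Fin (n + 1)) (Fin (n + 1)) K).submatrix r c).permanent =
      rename (Prod.map r c) (perPoly (Fin n) K) := by
  simp [perPoly, Matrix.permanent, map_sum, map_prod, Matrix.mvPolynomialX, Matrix.submatrix]

/-- `a = Per(X_{kk})` is the generic `n × n` permanent renamed into the rows and columns `< k`.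
[cite: BlaserIkenmeyerJindalLysikov2018, §6 (construction of `Z`)] locator: ECCC p.18 -/
theorem lastMinor_eq_rename : lastMinor K n =
    rename (Prod.map (Fin.last n).succAbove (Fin.last n).succAbove) (perPoly (Fin n) K) :=
  permanent_submatrix_mvPolynomialX _ _

/-- `Per(X_{kj})` is the generic `n × n` permanent renamed into the rows `< k` and columns `≠ j`.
[cite: BlaserIkenmeyerJindalLysikov2018, §6 (construction of `Z`)] locator: ECCC p.18 -/
theorem colMinor_eq_rename (j' : Fin n) : colMinor K n j' =
    rename (Prod.map (Fin.last n).succAbove (Fin.castSucc j').succAbove) (perPoly (Fin n) K) :=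
  permanent_submatrix_mvPolynomialX _ _

/-- `a = Per(X_{kk}) ≠ 0`. [cite: BlaserIkenmeyerJindalLysikov2018, §6 ("`Per Z_{nn} ≠ 0`")]
locator: ECCC p.18 -/
theorem lastMinor_ne_zero : lastMinor K n ≠ 0 := by
  rw [lastMinor_eq_rename]
  exact (map_ne_zero_iff _ (rename_injective _
    (Fin.succAbove_right_injective.prodMap Fin.succAbove_right_injective))).2 (perPoly_ne_zero _ _)

/-- **Laplace expansion along the last row: `Per X = x_{kk}·a + b`.**
[cite: BlaserIkenmeyerJindalLysikov2018, §6 ("by Laplace expansion")] locator: ECCC p.18 -/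
theorem perPoly_eq_X_mul_lastMinor_add :
    perPoly (Fin (n + 1)) K = X (Fin.last n, Fin.last n) * lastMinor K n + lastRowSum K n := by
  rw [perPoly, Matrix.permanent_eq_sum_row _ (Fin.last n), Fin.sum_univ_castSucc]
  exact add_comm _ _

/-- Two ring homomorphisms out of `K[x]` that agree on constants and on the variables in the range
of `ι` agree on every polynomial renamed along `ι` (plumbing). [folklore] -/
private theorem ringHom_apply_rename_eq {σ τ A : Type*} [CommSemiring A]
    (φ ψ : MvPolynomial σ K →+* A) (ι : τ → σ) (hC : ∀ c, φ (C c) = ψ (C c))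
    (hX : ∀ t, φ (X (ι t)) = ψ (X (ι t))) (q : MvPolynomial τ K) :
    φ (rename ι q) = ψ (rename ι q) := by
  have h : φ.comp (rename ι : MvPolynomial τ K →ₐ[K] MvPolynomial σ K).toRingHom =
      ψ.comp (rename ι : MvPolynomial τ K →ₐ[K] MvPolynomial σ K).toRingHom :=
    ringHom_ext (fun c => by simp [hC]) (fun t => by simp [hX])
  simpa using RingHom.congr_fun h q

/-- **`Per(Z(X)) = 0` as a polynomial identity: `zSubst (Per) = 0`.**
[cite: BlaserIkenmeyerJindalLysikov2018, §6 ("We have `Per Z = 0`")] locator: ECCC p.18 -/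
theorem zSubst_perPoly : zSubst K n (perPoly (Fin (n + 1)) K) = 0 := by
  have h : zSubst K n (perPoly (Fin (n + 1)) K) =
      (zMatrix (Matrix.mvPolynomialX (Fin (n + 1)) (Fin (n + 1)) K)).permanent := by
    simp [zSubst, zPoint, perPoly, Matrix.permanent, map_sum, map_prod, Matrix.mvPolynomialX]
  rw [h]
  exact permanent_zMatrix_eq_zero _

/-- Easy half: multiples of `Per` are killed by the self-reduction substitution.
[cite: BlaserIkenmeyerJindalLysikov2018, §6 (proof of Thm. 5, steps 3–4)] locator: ECCC p.18 -/
theorem zSubst_eq_zero_of_perPoly_dvd {C₀ : MvPolynomial (Fin (n + 1) × Fin (n + 1)) K}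
    (h : perPoly (Fin (n + 1)) K ∣ C₀) : zSubst K n C₀ = 0 := by
  obtain ⟨u, rfl⟩ := h
  rw [map_mul, zSubst_perPoly, zero_mul]

/-! #### Internal gadgets: `x_{kk} ↦ Y`, the root `−b/a` in the fraction field, the unscaling map -/

/-- `K[x] → K[x][Y]`, `x_{kk} ↦ Y`, every other variable `x_v ↦ x_v` (as a constant); internal
plumbing for the division argument. [folklore] -/
private def toPolyLast : MvPolynomial (Fin (n + 1) × Fin (n + 1)) K →+*
    Polynomial (MvPolynomial (Fin (n + 1) × Fin (n + 1)) K) :=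
  eval₂Hom (Polynomial.C.comp C) fun v =>
    if v = (Fin.last n, Fin.last n) then Polynomial.X else Polynomial.C (X v)

/-- `toPolyLast` on constants (plumbing). [folklore] -/
private theorem toPolyLast_C (c : K) : toPolyLast (K := K) (n := n) (C c) = Polynomial.C (C c) := by
  simp [toPolyLast]

/-- `toPolyLast (x_{kk}) = Y` (plumbing). [folklore] -/
private theorem toPolyLast_X_last :
    toPolyLast (K := K) (n := n) (X (Fin.last n, Fin.last n)) = Polynomial.X := by
  simp [toPolyLast]

/-- `toPolyLast (x_v) = x_v` for `v ≠ (k,k)` (plumbing). [folklore] -/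
private theorem toPolyLast_X_of_ne {v : Fin (n + 1) × Fin (n + 1)} (hv : v ≠ (Fin.last n, Fin.last n)) :
    toPolyLast (K := K) (n := n) (X v) = Polynomial.C (X v) := by
  simp [toPolyLast, hv]

/-- Substituting `Y ↦ x_{kk}` undoes `toPolyLast` (plumbing). [folklore] -/
private theorem eval_toPolyLast (f : MvPolynomial (Fin (n + 1) × Fin (n + 1)) K) :
    Polynomial.eval (X (Fin.last n, Fin.last n)) (toPolyLast f) = f := by
  have h : (Polynomial.evalRingHom (X (Fin.last n, Fin.last n))).comp (toPolyLast (K := K) (n := n)) =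
      RingHom.id _ := by
    refine ringHom_ext (fun c => by simp [toPolyLast_C]) (fun v => ?_)
    by_cases hv : v = (Fin.last n, Fin.last n)
    · subst hv; simp [toPolyLast_X_last]
    · simp [toPolyLast_X_of_ne hv]
  simpa using RingHom.congr_fun h f

/-- `toPolyLast` fixes (as constants) polynomials not involving the last row (plumbing). [folklore] -/
private theorem toPolyLast_rename {τ : Type*} (ι : τ → Fin (n + 1) × Fin (n + 1))
    (hι : ∀ t, (ι t).1 ≠ Fin.last n) (q : MvPolynomial τ K) :
    toPolyLast (K := K) (n := n) (rename ι q) = Polynomial.C (rename ι q) := by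
  refine ringHom_apply_rename_eq (toPolyLast (K := K) (n := n)) Polynomial.C ι
    (fun c => toPolyLast_C c) (fun t => toPolyLast_X_of_ne ?_) q
  intro h
  exact hι t (by rw [h])

/-- `toPolyLast a = a` (plumbing). [folklore] -/
private theorem toPolyLast_lastMinor :
    toPolyLast (K := K) (n := n) (lastMinor K n) = Polynomial.C (lastMinor K n) := by
  rw [lastMinor_eq_rename]
  exact toPolyLast_rename _ (fun t => Fin.succAbove_ne _ _) _

/-- `toPolyLast b = b` (plumbing). [folklore] -/
private theorem toPolyLast_lastRowSum :
    toPolyLast (K := K) (n := n) (lastRowSum K n) = Polynomial.C (lastRowSum K n) := by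
  rw [lastRowSum, map_sum, map_sum]
  refine Finset.sum_congr rfl fun j' _ => ?_
  rw [map_mul, map_mul, colMinor_eq_rename, toPolyLast_rename _ (fun t => Fin.succAbove_ne _ _),
    toPolyLast_X_of_ne]
  intro h
  exact (Fin.castSucc_lt_last j').ne (Prod.mk.inj h).2

/-- `toPolyLast (Per) = a·Y + b` (plumbing form of the Laplace expansion). [folklore] -/
private theorem toPolyLast_perPoly : toPolyLast (K := K) (n := n) (perPoly (Fin (n + 1)) K) =
    Polynomial.C (lastMinor K n) * Polynomial.X + Polynomial.C (lastRowSum K n) := by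
  rw [perPoly_eq_X_mul_lastMinor_add, map_add, map_mul, toPolyLast_X_last, toPolyLast_lastMinor,
    toPolyLast_lastRowSum, mul_comm]

/-- **`Per ∤ a`** (`a = Per(X_{kk})` does not involve `x_{kk}`, `Per` does).
[cite: BlaserIkenmeyerJindalLysikov2018, §6 (proof of Thm. 5, step 4)] locator: ECCC p.18 -/
theorem not_perPoly_dvd_lastMinor : ¬ perPoly (Fin (n + 1)) K ∣ lastMinor K n := by
  intro h
  have h' := map_dvd (toPolyLast (K := K) (n := n)) h
  rw [toPolyLast_perPoly, toPolyLast_lastMinor] at h'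
  have hne : Polynomial.C (lastMinor K n) ≠ 0 := Polynomial.C_ne_zero.2 lastMinor_ne_zero
  have hle := Polynomial.natDegree_le_of_dvd h' hne
  rw [Polynomial.natDegree_linear lastMinor_ne_zero, Polynomial.natDegree_C] at hle
  exact Nat.not_succ_le_zero 0 hle

/-- The fraction field `K(x)` of `K[x]` (host of the root `x_{kk} = −b/a` of `Per = a·x_{kk} + b`);
internal plumbing. [folklore] -/
private abbrev FF : Type u := FractionRing (MvPolynomial (Fin (n + 1) × Fin (n + 1)) K)

/-- The embedding `K[x] → K(x)` (plumbing). [folklore] -/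
private abbrev toFF : MvPolynomial (Fin (n + 1) × Fin (n + 1)) K →+* FF (K := K) (n := n) :=
  algebraMap _ _

/-- `K[x] → K(x)` is injective (plumbing). [folklore] -/
private theorem toFF_injective : Function.Injective (toFF (K := K) (n := n)) :=
  IsFractionRing.injective _ _

/-- `a ≠ 0` in `K(x)` (plumbing). [folklore] -/
private theorem toFF_lastMinor_ne_zero : toFF (K := K) (n := n) (lastMinor K n) ≠ 0 :=
  (map_ne_zero_iff _ toFF_injective).2 lastMinor_ne_zero

/-- Evaluation at the `K(x)`-point `x_v ↦ x_v` (`v ≠ (k,k)`), `x_{kk} ↦ −b/a` — a root of `Per`;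
internal plumbing. [folklore] -/
private def rootEval : MvPolynomial (Fin (n + 1) × Fin (n + 1)) K →+* FF (K := K) (n := n) :=
  eval₂Hom ((toFF (K := K) (n := n)).comp C) fun v =>
    if v = (Fin.last n, Fin.last n) then -(toFF (lastRowSum K n) / toFF (lastMinor K n))
    else toFF (X v)

/-- The unscaling map `x_{kj} ↦ x_{kj}/a` (`j < k`), all other variables fixed, into `K(x)`;
internal plumbing. [folklore] -/
private def unscale : MvPolynomial (Fin (n + 1) × Fin (n + 1)) K →+* FF (K := K) (n := n) :=
  eval₂Hom ((toFF (K := K) (n := n)).comp C) fun v =>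
    if v.1 = Fin.last n ∧ v.2 ≠ Fin.last n then toFF (X v) / toFF (lastMinor K n) else toFF (X v)

/-- `unscale` fixes polynomials not involving the last row (plumbing). [folklore] -/
private theorem unscale_rename {τ : Type*} (ι : τ → Fin (n + 1) × Fin (n + 1))
    (hι : ∀ t, (ι t).1 ≠ Fin.last n) (q : MvPolynomial τ K) :
    unscale (K := K) (n := n) (rename ι q) = toFF (rename ι q) := by
  refine ringHom_apply_rename_eq unscale toFF ι (fun c => by simp [unscale]) (fun t => ?_) q
  simp [unscale, hι t]

/-- `unscale a = a` (plumbing). [folklore] -/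
private theorem unscale_lastMinor : unscale (K := K) (n := n) (lastMinor K n) = toFF (lastMinor K n) := by
  rw [lastMinor_eq_rename]
  exact unscale_rename _ (fun t => Fin.succAbove_ne _ _) _

/-- `unscale Per(X_{kj}) = Per(X_{kj})` (plumbing). [folklore] -/
private theorem unscale_colMinor (j' : Fin n) :
    unscale (K := K) (n := n) (colMinor K n j') = toFF (colMinor K n j') := by
  rw [colMinor_eq_rename]
  exact unscale_rename _ (fun t => Fin.succAbove_ne _ _) _

/-- `unscale b = b/a` (plumbing). [folklore] -/
private theorem unscale_lastRowSum : unscale (K := K) (n := n) (lastRowSum K n) =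
    toFF (lastRowSum K n) / toFF (lastMinor K n) := by
  rw [lastRowSum, map_sum, map_sum, Finset.sum_div]
  refine Finset.sum_congr rfl fun j' _ => ?_
  have hne : Fin.castSucc j' ≠ Fin.last n := (Fin.castSucc_lt_last j').ne
  have hX : unscale (K := K) (n := n) (X (Fin.last n, Fin.castSucc j')) =
      toFF (X (Fin.last n, Fin.castSucc j')) / toFF (lastMinor K n) := by
    simp [unscale, hne]
  rw [map_mul, map_mul, unscale_colMinor, hX, div_mul_eq_mul_div]

/-- Key plumbing identity: unscaling after the self-reduction substitution is evaluation at the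
root `x_{kk} = −b/a` (`unscale ∘ zSubst = rootEval`). [folklore] -/
private theorem unscale_comp_zSubst :
    (unscale (K := K) (n := n)).comp (zSubst K n : _ →+* _) = rootEval := by
  refine ringHom_ext (fun c => by simp [unscale, rootEval, zSubst]) (fun v => ?_)
  rcases v with ⟨i, j⟩
  rw [RingHom.comp_apply, RingHom.coe_coe, zSubst_X]
  by_cases hi : i = Fin.last n
  · subst hi
    by_cases hj : j = Fin.last n
    · subst hj
      rw [zPoint_last_last, map_neg, unscale_lastRowSum]
      simp [rootEval]
    · rw [zPoint_last_of_ne hj, map_mul, unscale_lastMinor]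
      have h1 : unscale (K := K) (n := n) (X (Fin.last n, j)) =
          toFF (X (Fin.last n, j)) / toFF (lastMinor K n) := by simp [unscale, hj]
      have h2 : rootEval (K := K) (n := n) (X (Fin.last n, j)) = toFF (X (Fin.last n, j)) := by
        simp [rootEval, hj]
      rw [h1, h2, div_mul_cancel₀ _ toFF_lastMinor_ne_zero]
  · rw [zPoint_of_ne (v := (i, j)) hi]
    have hne : ((i, j) : Fin (n + 1) × Fin (n + 1)) ≠ (Fin.last n, Fin.last n) := by
      intro h; exact hi (Prod.mk.inj h).1
    simp [unscale, rootEval, hi, hne]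

/-- `rootEval` is `toPolyLast` followed by evaluation of `Y` at `−b/a` (plumbing). [folklore] -/
private theorem eval₂_toPolyLast (f : MvPolynomial (Fin (n + 1) × Fin (n + 1)) K) :
    (toPolyLast f).eval₂ toFF (-(toFF (lastRowSum K n) / toFF (lastMinor K n))) =
      rootEval (K := K) (n := n) f := by
  have h : (Polynomial.eval₂RingHom (toFF (K := K) (n := n))
      (-(toFF (lastRowSum K n) / toFF (lastMinor K n)))).comp toPolyLast = rootEval := by
    refine ringHom_ext (fun c => by simp [toPolyLast_C, rootEval]) (fun v => ?_)
    by_cases hv : v = (Fin.last n, Fin.last n)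
    · subst hv; simp [toPolyLast_X_last, rootEval]
    · simp [toPolyLast_X_of_ne hv, rootEval, hv]
  simpa using RingHom.congr_fun h f

/-- **Hard half (ECCC p.18, step 4): if `C(Z(X)) = 0` then `Per ∣ C`.** Route: `C(Z(X)) = 0`
forces `C` to vanish at the `K(x)`-point `x_{kk} = −b/a` (`unscale_comp_zSubst`); scaling the roots
of `C ∈ K[x'][Y]` by `a` gives a polynomial with the root `−b ∈ K[x']`, whence
`(a·Y + b) ∣ a^N·C` in `K[x][Y]` and, substituting `Y = x_{kk}`, `Per ∣ a^N·C` in `K[x]`; `Per` is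
prime (`perPoly_irreducible`) and `Per ∤ a`. [cite: BlaserIkenmeyerJindalLysikov2018, §6 (proof of Thm. 5, step 4)]
locator: ECCC p.18 -/
theorem perPoly_dvd_of_zSubst_eq_zero {C₀ : MvPolynomial (Fin (n + 1) × Fin (n + 1)) K}
    (hZ : zSubst K n C₀ = 0) : perPoly (Fin (n + 1)) K ∣ C₀ := by
  -- Step 1: `C₀` vanishes at the root point.
  have h1 : rootEval (K := K) (n := n) C₀ = 0 := by
    rw [← unscale_comp_zSubst, RingHom.comp_apply, RingHom.coe_coe, hZ, map_zero]
  -- Step 2: so does `p := toPolyLast C₀ ∈ K[x][Y]` at `Y = -b/a`.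
  set a := lastMinor K n with ha
  set b := lastRowSum K n with hb
  set p := toPolyLast (K := K) (n := n) C₀ with hp
  have h2 : p.eval₂ toFF (-(toFF b / toFF a)) = 0 := by rw [hp, eval₂_toPolyLast, h1]
  -- Step 3: `scaleRoots p a` has the root `-b ∈ K[x]`.
  have h3 : (p.scaleRoots a).IsRoot (-b) := by
    have hs := Polynomial.scaleRoots_eval₂_mul (p := p) toFF (-(toFF b / toFF a)) a
    rw [h2, mul_zero] at hs
    have hab : toFF (K := K) (n := n) a * -(toFF b / toFF a) = toFF (-b) := by
      rw [map_neg, mul_neg, mul_div_cancel₀ _ toFF_lastMinor_ne_zero]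
    rw [hab, Polynomial.eval₂_hom] at hs
    exact (map_eq_zero_iff _ toFF_injective).1 hs
  -- Step 4: `(Y + b) ∣ scaleRoots p a`, and unscaling `Y ↦ a·Y`: `(a·Y + b) ∣ a^N · p`.
  obtain ⟨Q, hQ⟩ := (Polynomial.dvd_iff_isRoot.2 h3)
  have h5 : Polynomial.C a ^ p.natDegree * p =
      (Polynomial.C a * Polynomial.X + Polynomial.C b) *
        Q.eval₂ Polynomial.C (Polynomial.C a * Polynomial.X) := by
    have hs := Polynomial.scaleRoots_eval₂_mul (p := p) Polynomial.C Polynomial.X a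
    rw [Polynomial.eval₂_C_X, hQ, Polynomial.eval₂_mul, Polynomial.eval₂_sub, Polynomial.eval₂_X,
      Polynomial.eval₂_C, map_neg, sub_neg_eq_add] at hs
    exact hs.symm
  -- Step 5: substitute `Y = x_{kk}`: `Per ∣ a^N · C₀`.
  have h6 : perPoly (Fin (n + 1)) K ∣ a ^ p.natDegree * C₀ := by
    have hev := congrArg (Polynomial.eval (X (Fin.last n, Fin.last n))) h5
    rw [Polynomial.eval_mul, Polynomial.eval_pow, Polynomial.eval_C, hp, eval_toPolyLast,
      Polynomial.eval_mul] at hev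
    refine ⟨Polynomial.eval (X (Fin.last n, Fin.last n))
      (Q.eval₂ Polynomial.C (Polynomial.C a * Polynomial.X)), hev.trans ?_⟩
    congr 1
    rw [Polynomial.eval_add, Polynomial.eval_mul, Polynomial.eval_C, Polynomial.eval_X,
      Polynomial.eval_C, perPoly_eq_X_mul_lastMinor_add, mul_comm]
  -- Step 6: `Per` is prime and does not divide `a`.
  have hprime : Prime (perPoly (Fin (n + 1)) K) :=
    UniqueFactorizationMonoid.irreducible_iff_prime.mp perPoly_irreducible
  rcases hprime.dvd_or_dvd h6 with h | h
  · exact absurd (hprime.dvd_of_dvd_pow h) not_perPoly_dvd_lastMinor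
  · exact h

/-- **The kernel of the self-reduction substitution is `(Per)`: `Per ∣ C ↔ C(Z(X)) = 0`** (every
field `K`; the algebraic content of ECCC p.18, step 4, given step 3).
[cite: BlaserIkenmeyerJindalLysikov2018, §6 (proof of Thm. 5, steps 3–4)] locator: ECCC p.18 -/
theorem perPoly_dvd_iff_zSubst_eq_zero (C₀ : MvPolynomial (Fin (n + 1) × Fin (n + 1)) K) :
    perPoly (Fin (n + 1)) K ∣ C₀ ↔ zSubst K n C₀ = 0 :=
  ⟨zSubst_eq_zero_of_perPoly_dvd, perPoly_dvd_of_zSubst_eq_zero⟩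

/-- The same, as an equality of ideals: `ker (C ↦ C(Z(X))) = (Per)`.
[cite: BlaserIkenmeyerJindalLysikov2018, §6 (proof of Thm. 5, steps 3–4)] locator: ECCC p.18 -/
theorem ker_zSubst_eq_span_perPoly :
    RingHom.ker (zSubst K n : _ →+* MvPolynomial (Fin (n + 1) × Fin (n + 1)) K) =
      Ideal.span {perPoly (Fin (n + 1)) K} := by
  ext C₀
  rw [RingHom.mem_ker, RingHom.coe_coe, Ideal.mem_span_singleton, perPoly_dvd_iff_zSubst_eq_zero]

/-- **Step 4 in its printed multiplicity form.** If `C ≠ 0` and `C(Z(X)) = 0` then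
`C = Per^e · h` with `e ≥ 1`, `Per ∤ h` (so `gcd(Per^e, h) = 1`, `Per` being prime) and
`e·k ≤ deg C` ("`e ≤ d(k)/k`"). [cite: BlaserIkenmeyerJindalLysikov2018, §6 (proof of Thm. 5, step 4)]
locator: ECCC p.18 -/
theorem exists_eq_perPoly_pow_mul {C₀ : MvPolynomial (Fin (n + 1) × Fin (n + 1)) K} (hC : C₀ ≠ 0)
    (hZ : zSubst K n C₀ = 0) :
    ∃ (e : ℕ) (h : MvPolynomial (Fin (n + 1) × Fin (n + 1)) K), 1 ≤ e ∧
      C₀ = perPoly (Fin (n + 1)) K ^ e * h ∧ ¬ perPoly (Fin (n + 1)) K ∣ h ∧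
      e * (n + 1) ≤ C₀.totalDegree := by
  classical
  set P := perPoly (Fin (n + 1)) K with hPdef
  have hP0 : P ≠ 0 := perPoly_ne_zero _ _
  have hPdeg : ∀ e : ℕ, (P ^ e).totalDegree = e * (n + 1) := by
    intro e
    have hh : (P ^ e).IsHomogeneous (Fintype.card (Fin (n + 1)) * e) := perPoly_isHomogeneous.pow e
    rw [hh.totalDegree (pow_ne_zero e hP0), Fintype.card_fin, mul_comm]
  have hbound : ∀ e : ℕ, P ^ e ∣ C₀ → e * (n + 1) ≤ C₀.totalDegree := fun e he => by
    rw [← hPdeg e]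
    exact totalDegree_le_of_dvd_of_isDomain he hC
  have hex : ∃ e : ℕ, ¬ P ^ (e + 1) ∣ C₀ := by
    refine ⟨C₀.totalDegree, fun h => ?_⟩
    have := hbound _ h
    nlinarith
  have he : ¬ P ^ (Nat.find hex + 1) ∣ C₀ := Nat.find_spec hex
  have hdvd : P ∣ C₀ := perPoly_dvd_of_zSubst_eq_zero hZ
  have he0 : Nat.find hex ≠ 0 := by
    intro h0
    rw [h0, zero_add, pow_one] at he
    exact he hdvd
  have hePe : P ^ Nat.find hex ∣ C₀ := by
    obtain ⟨e', he'⟩ := Nat.exists_eq_succ_of_ne_zero he0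
    have hmin := Nat.find_min hex (m := e') (by omega)
    rw [not_not] at hmin
    rw [he']
    exact hmin
  obtain ⟨h, hh⟩ := hePe
  refine ⟨Nat.find hex, h, Nat.one_le_iff_ne_zero.mpr he0, hh, fun hPh => he ?_, hbound _ ⟨h, hh⟩⟩
  obtain ⟨h', hh'⟩ := hPh
  refine ⟨h', ?_⟩
  conv_lhs => rw [hh, hh']
  ring

end Field

/-! ### The set-theoretic reading (infinite fields): vanishing on `{Per = 0}` -/

section Infinite

variable {K : Type u} [Field K]

/-- Evaluating `C(Z(X))` at a point `x ∈ K^{k×k}` is evaluating `C` at the matrix `Z(x)` (the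
randomised PIT of step 3 evaluates exactly these). [cite: BlaserIkenmeyerJindalLysikov2018, §6 (proof of Thm. 5, step 3)]
locator: ECCC p.18 -/
theorem eval_zSubst {n : ℕ} (x : Fin (n + 1) × Fin (n + 1) → K)
    (D : MvPolynomial (Fin (n + 1) × Fin (n + 1)) K) :
    eval x (zSubst K n D) =
      eval (fun v => zMatrix (Matrix.of fun i j : Fin (n + 1) => x (i, j)) v.1 v.2) D := by
  have hz : ∀ v, eval x (zPoint K n v) =
      zMatrix (Matrix.of fun i j : Fin (n + 1) => x (i, j)) v.1 v.2 := by
    intro v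
    have hmap : (Matrix.mvPolynomialX (Fin (n + 1)) (Fin (n + 1)) K).map (eval x) =
        Matrix.of fun i j : Fin (n + 1) => x (i, j) := by
      ext i j
      simp [Matrix.mvPolynomialX]
    rw [zPoint, ← hmap, ← zMatrix_map]
    rfl
  have hcomp : (eval x).comp (zSubst K n : _ →+* MvPolynomial (Fin (n + 1) × Fin (n + 1)) K) =
      eval (fun v : Fin (n + 1) × Fin (n + 1) =>
        zMatrix (Matrix.of fun i j : Fin (n + 1) => x (i, j)) v.1 v.2) :=
    ringHom_ext (fun c => by simp) (fun v => by
      rw [RingHom.comp_apply, RingHom.coe_coe, zSubst_X, hz, eval_X])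
  exact RingHom.congr_fun hcomp D

/-- **A polynomial vanishing at every matrix of permanent zero is a multiple of `Per`** (infinite
field `K`; the reading of step 4 used in the proof of Thm. 6, ECCC p.19: "`C_k` … computes a
polynomial that vanishes on all `k×k`-matrices" of permanent zero). Only the matrices `Z(x)`,
`x ∈ K^{k×k}`, are used. [cite: BlaserIkenmeyerJindalLysikov2018, §6 (proofs of Thms. 5–6, step 4)]
locator: ECCC pp.18–19 -/
theorem perPoly_dvd_of_forall_permanent_eq_zero [Infinite K] {m : ℕ}
    (D : MvPolynomial (Fin m × Fin m) K)
    (hD : ∀ A : Matrix (Fin m) (Fin m) K, A.permanent = 0 → eval (fun v => A v.1 v.2) D = 0) :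
    perPoly (Fin m) K ∣ D := by
  cases m with
  | zero =>
    have h1 : perPoly (Fin 0) K = 1 := by
      rw [perPoly]
      exact Matrix.permanent_isEmpty
    rw [h1]
    exact one_dvd _
  | succ n =>
    refine perPoly_dvd_of_zSubst_eq_zero (MvPolynomial.funext fun x => ?_)
    rw [map_zero, eval_zSubst]
    exact hD _ (permanent_zMatrix_eq_zero _)

end Infinite

end PerZeroDivisibility

/-! ### Thm. 6's hypothesis in algebraic normal form -/

section ThmSixHypothesis

open PerZeroDivisibility

/-- **`VP⁰`-natural proofs against `{Per = 0}` are exactly `VP⁰` families of nonzero multiples of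
the permanent.** The typed hypothesis `HasVP0NaturalProofsAgainstPerZero` of the LOAD-BEARING fact
`BIJL2018_thm6` (a `VP⁰` family `D_n ≠ 0` vanishing at every rational matrix of permanent zero) is
equivalent to: some `VP⁰` family `(D_n)` has `D_n ≠ 0` and `Per_n ∣ D_n` in `ℚ[x]` for every `n`
(step 4 of the printed proof, ECCC pp.18–19, in both directions; the paper: "Note that this set has
a `VNP⁰`-natural proof, namely the permanent itself").
[cite: BlaserIkenmeyerJindalLysikov2018, §6 (Thm. 6 and proof of Thm. 5, step 4)] locator: ECCC pp.17–19 -/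
theorem hasVP0NaturalProofsAgainstPerZero_iff_perPoly_dvd :
    HasVP0NaturalProofsAgainstPerZero ↔
      ∃ D : ∀ n : ℕ, MvPolynomial (Fin n × Fin n) ℤ, IsVP0Family D ∧
        ∀ n, D n ≠ 0 ∧ perPoly (Fin n) ℚ ∣ map (Int.castRingHom ℚ) (D n) := by
  constructor
  · rintro ⟨D, hVP, hD⟩
    refine ⟨D, hVP, fun n => ⟨(hD n).1, perPoly_dvd_of_forall_permanent_eq_zero _ fun A hA => ?_⟩⟩
    rw [eval_map, ← algebraMap_int_eq]
    have h := (hD n).2 A hA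
    rwa [aeval_def] at h
  · rintro ⟨D, hVP, hD⟩
    refine ⟨D, hVP, fun n => ⟨(hD n).1, fun A hA => ?_⟩⟩
    obtain ⟨u, hu⟩ := (hD n).2
    have hper : eval (fun v : Fin n × Fin n => A v.1 v.2) (perPoly (Fin n) ℚ) = A.permanent := by
      rw [eval_perPoly]
      rfl
    rw [aeval_def, algebraMap_int_eq, ← eval_map, hu, map_mul, hper, hA, zero_mul]

end ThmSixHypothesis


/-! ### Steps 5 and 7 of the printed algorithm: reduction modulo `p` and identification of the
factor `Per` (appended; theorem-only) -/

section StepsFiveSeven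

open PerZeroDivisibility

/-- **Step 7 (ECCC p.19): "If this PIT succeeds then we know that `gᵢ` has to be `Per_k` since
`gᵢ` is irreducible."** Over every field: an irreducible `g` with `g(Z(X)) = 0` is an associate of
`Per`. [cite: BlaserIkenmeyerJindalLysikov2018, §6 (proof of Thm. 5, step 7)] locator: ECCC p.19 -/
theorem associated_perPoly_of_irreducible_of_zSubst_eq_zero {K : Type u} [Field K] {n : ℕ}
    {g : MvPolynomial (Fin (n + 1) × Fin (n + 1)) K} (hg : Irreducible g)
    (hZ : zSubst K n g = 0) : Associated (perPoly (Fin (n + 1)) K) g :=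
  perPoly_irreducible.associated_of_dvd hg (perPoly_dvd_of_zSubst_eq_zero hZ)

/-- The integer version of the self-reduction point `Z(X)` maps to the one over any commutative
ring with one (base change along `ℤ → K`). [cite: BlaserIkenmeyerJindalLysikov2018, §6 (proof of Thm. 5, step 5)]
locator: ECCC p.18 -/
theorem map_intCast_zPoint {K : Type u} [Field K] {n : ℕ} (v : Fin (n + 1) × Fin (n + 1)) :
    map (Int.castRingHom K) (zMatrix (Matrix.mvPolynomialX (Fin (n + 1)) (Fin (n + 1)) ℤ) v.1 v.2) =
      zPoint K n v := by
  have hX : (Matrix.mvPolynomialX (Fin (n + 1)) (Fin (n + 1)) ℤ).map (map (Int.castRingHom K)) =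
      Matrix.mvPolynomialX (Fin (n + 1)) (Fin (n + 1)) K := by
    ext i j
    simp [Matrix.mvPolynomialX]
  rw [zPoint, ← hX, ← zMatrix_map]
  rfl

/-- **Base change of the self-reduction substitution** ("even over `𝔽_p[x]`", step 5): for an
integer polynomial `D`, `(D(Z(X))) mod K = (D mod K)(Z(X))` for every field `K`.
[cite: BlaserIkenmeyerJindalLysikov2018, §6 (proof of Thm. 5, step 5)] locator: ECCC p.18 -/
theorem map_intCast_aeval_zMatrix {K : Type u} [Field K] {n : ℕ}
    (D : MvPolynomial (Fin (n + 1) × Fin (n + 1)) ℤ) :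
    map (Int.castRingHom K)
        (aeval (fun v : Fin (n + 1) × Fin (n + 1) =>
          zMatrix (Matrix.mvPolynomialX (Fin (n + 1)) (Fin (n + 1)) ℤ) v.1 v.2) D) =
      zSubst K n (map (Int.castRingHom K) D) := by
  have h : (map (Int.castRingHom K)).comp
      (aeval (fun v : Fin (n + 1) × Fin (n + 1) =>
        zMatrix (Matrix.mvPolynomialX (Fin (n + 1)) (Fin (n + 1)) ℤ) v.1 v.2) :
          MvPolynomial _ ℤ →ₐ[ℤ] MvPolynomial (Fin (n + 1) × Fin (n + 1)) ℤ).toRingHom =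
      (zSubst K n : _ →+* MvPolynomial (Fin (n + 1) × Fin (n + 1)) K).comp
        (map (Int.castRingHom K)) := by
    refine ringHom_ext (fun c => by simp [zSubst]) (fun v => ?_)
    simp only [RingHom.comp_apply, AlgHom.toRingHom_eq_coe, RingHom.coe_coe, aeval_X, map_X,
      zSubst_X]
    exact map_intCast_zPoint v
  exact RingHom.congr_fun h D

/-- **Step 5 in divisibility form, every field: an integer polynomial vanishing at every rational
matrix of permanent zero is a multiple of `Per` after ANY base change `ℤ → K`** — in particular
over `𝔽_p` ("`C_k = (Per_k)^e h` even over `𝔽_p[x_{1,1}, …, x_{k,k}]`"). The rational case gives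
the polynomial identity `D(Z(X)) = 0` over `ℤ` (injectivity of `ℤ → ℚ`), which base-changes.
[cite: BlaserIkenmeyerJindalLysikov2018, §6 (proof of Thm. 5, step 5)] locator: ECCC p.18 -/
theorem perPoly_dvd_map_intCast_of_forall_permanent_eq_zero (K : Type u) [Field K] {m : ℕ}
    (D : MvPolynomial (Fin m × Fin m) ℤ)
    (hD : ∀ A : Matrix (Fin m) (Fin m) ℚ, A.permanent = 0 →
      aeval (fun ij : Fin m × Fin m => A ij.1 ij.2) D = 0) :
    perPoly (Fin m) K ∣ map (Int.castRingHom K) D := by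
  cases m with
  | zero =>
    have h1 : perPoly (Fin 0) K = 1 := by
      rw [perPoly]
      exact Matrix.permanent_isEmpty
    rw [h1]
    exact one_dvd _
  | succ n =>
    -- over `ℚ`: `(map D)(Z(X)) = 0`
    have hQ : zSubst ℚ n (map (Int.castRingHom ℚ) D) = 0 := by
      refine MvPolynomial.funext fun x => ?_
      rw [map_zero, eval_zSubst, eval_map, ← algebraMap_int_eq]
      have h := hD _ (permanent_zMatrix_eq_zero (Matrix.of fun i j : Fin (n + 1) => x (i, j)))
      rwa [aeval_def] at h
    -- hence over `ℤ`, hence over `K`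
    have hZ : aeval (fun v : Fin (n + 1) × Fin (n + 1) =>
        zMatrix (Matrix.mvPolynomialX (Fin (n + 1)) (Fin (n + 1)) ℤ) v.1 v.2) D = 0 := by
      apply map_injective (Int.castRingHom ℚ) Int.cast_injective
      rw [map_intCast_aeval_zMatrix, hQ, map_zero]
    refine perPoly_dvd_of_zSubst_eq_zero ?_
    rw [← map_intCast_aeval_zMatrix, hZ, map_zero]

/-- **Step 5, non-vanishing modulo `p`: "we choose a prime `p > max{B, n!}`", `B ≥ Σ |coeff|`**
(Lemma 25). If `0 ≠ D ∈ ℤ[x]` and `Σ |coeff D| < p` then `D mod p ≠ 0`.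
[cite: BlaserIkenmeyerJindalLysikov2018, §6 (proof of Thm. 5, step 5)] locator: ECCC p.18 -/
theorem map_intCast_zmod_ne_zero_of_coeffAbsSum_lt {σ : Type*} {D : MvPolynomial σ ℤ} (hD : D ≠ 0)
    {p : ℕ} [Fact p.Prime] (hp : coeffAbsSum D < p) :
    map (Int.castRingHom (ZMod p)) D ≠ 0 := by
  classical
  obtain ⟨m, hm⟩ := MvPolynomial.ne_zero_iff.1 hD
  have hle : |coeff m D| ≤ coeffAbsSum D := by
    rw [coeffAbsSum]
    exact Finset.single_le_sum (f := fun m => |coeff m D|) (fun _ _ => abs_nonneg _)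
      (MvPolynomial.mem_support_iff.2 hm)
  intro h0
  have hc : (Int.castRingHom (ZMod p)) (coeff m D) = 0 := by
    rw [← coeff_map, h0, coeff_zero]
  rw [eq_intCast, ZMod.intCast_zmod_eq_zero_iff_dvd] at hc
  have : coeff m D = 0 := Int.eq_zero_of_abs_lt_dvd hc (by omega)
  exact hm this

/-- **Steps 4–5 over `𝔽_p` in the printed shape.** If `0 ≠ D ∈ ℤ[x_{ij}]` vanishes at every
rational `k × k` matrix of permanent zero and `Σ|coeff D| < p`, then over `𝔽_p` one still has
`D = Per_k^e · h` with `1 ≤ e`, `Per_k ∤ h` and `e·k ≤ deg D` ("By the choice of `p`, we see that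
`C_k = (Per_k)^e h` even over `𝔽_p[x_{1,1}, …, x_{k,k}]`"; multiplicities `< p` are then automatic
from `e·k ≤ deg D`, cf. step 6 "all `eᵢ = 0`").
[cite: BlaserIkenmeyerJindalLysikov2018, §6 (proof of Thm. 5, steps 4–5)] locator: ECCC pp.18–19 -/
theorem exists_eq_perPoly_pow_mul_zmod {n : ℕ} (D : MvPolynomial (Fin (n + 1) × Fin (n + 1)) ℤ)
    (hD0 : D ≠ 0)
    (hD : ∀ A : Matrix (Fin (n + 1)) (Fin (n + 1)) ℚ, A.permanent = 0 →
      aeval (fun ij : Fin (n + 1) × Fin (n + 1) => A ij.1 ij.2) D = 0)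
    (p : ℕ) [Fact p.Prime] (hp : coeffAbsSum D < p) :
    ∃ (e : ℕ) (h : MvPolynomial (Fin (n + 1) × Fin (n + 1)) (ZMod p)), 1 ≤ e ∧
      map (Int.castRingHom (ZMod p)) D = perPoly (Fin (n + 1)) (ZMod p) ^ e * h ∧
      ¬ perPoly (Fin (n + 1)) (ZMod p) ∣ h ∧ e * (n + 1) ≤ D.totalDegree := by
  have hne := map_intCast_zmod_ne_zero_of_coeffAbsSum_lt hD0 hp
  have hdvd := perPoly_dvd_map_intCast_of_forall_permanent_eq_zero (ZMod p) D hD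
  obtain ⟨e, h, he, hDe, hnd, hdeg⟩ :=
    exists_eq_perPoly_pow_mul hne (zSubst_eq_zero_of_perPoly_dvd hdvd)
  exact ⟨e, h, he, hDe, hnd, hdeg.trans (Finset.sup_mono (support_map_subset _ _))⟩

end StepsFiveSeven

end Literature.Barriers.ValiantsHypothesis

end
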